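import Mathlib

/-!
# Residue splitting for the fan sums of the crux `FanDecorrelation` (line `SketchIdeator1`)

Stub `stub_residueSplitting` of the crux `FanDecorrelation`
(`Summit.Parity.GeneralizedHardyLittlewood.Theses.LiouvilleMAD`, stmt-Parity-13318), line
`SketchIdeator1` (idea `lag-window-normal-form`).  With `Q = ⌊√M⌋ + 1`, the fan sum
`R_k = Σ_{j ∈ [Q,2Q)} Σ_{(m,m') ∈ (M,2M]², m − m' = k j} λ(m n + c) λ(m' n' + c)` is, for
`1 ≤ k ≤ M`, EXACTLY the sum over the residue classes `r < k` of the unit fans: the window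
`y − y' ∈ [Q, 2Q)` of the cross sum of `y ↦ λ((k y + r) n + c)`, `y' ↦ λ((k y' + r) n' + c)` over
the box `((M − r)/k, (2M − r)/k]²` (`ℕ`-division).  This is the reindexing `m = k y + r`,
`m' = k y' + r` (`r = m mod k = m' mod k` since `k ∣ m − m'`; `m ∈ (M, 2M] ↔ y ∈ ((M−r)/k,(2M−r)/k]`
because `r < k ≤ M`; each pair is counted once, for its unique `j = (m − m')/k`).  Pure finite
combinatorics over Mathlib (`Finset.sum_nbij'`).
-/

namespace Summit.Parity.GeneralizedHardyLittlewood.Theorems.FanDecorrelation.ResidueSplitting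

open ArithmeticFunction

/-- For `k ≥ 1` at most one `j` has `d = k j`; summing the indicator of `d = k j` over
`j ∈ [Qn, 2 Qn)` leaves the divisibility-and-window condition `k ∣ d`, `d / k ∈ [Qn, 2 Qn)`.
[folklore] -/
theorem sum_Ico_ite_eq_mul (d : ℤ) (k Qn : ℕ) (hk : 1 ≤ k) (x : ℝ) :
    (∑ j ∈ Finset.Ico Qn (2 * Qn), if d = (k : ℤ) * (j : ℤ) then x else 0) =
      if ((k : ℤ) ∣ d ∧ (Qn : ℤ) ≤ d / k ∧ d / k < 2 * (Qn : ℤ)) then x else 0 := by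
  have hk0 : (k : ℤ) ≠ 0 := by exact_mod_cast (show k ≠ 0 by omega)
  by_cases h : ((k : ℤ) ∣ d ∧ (Qn : ℤ) ≤ d / k ∧ d / k < 2 * (Qn : ℤ))
  · rw [if_pos h]
    obtain ⟨hdvd, hlo, hhi⟩ := h
    have hnn : 0 ≤ d / k := le_trans (by positivity) hlo
    set j₀ : ℕ := Int.toNat (d / k) with hj₀
    have hj₀c : (j₀ : ℤ) = d / k := by rw [hj₀, Int.toNat_of_nonneg hnn]
    have hmem : j₀ ∈ Finset.Ico Qn (2 * Qn) := by
      rw [Finset.mem_Ico]; constructor <;> omega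
    rw [Finset.sum_eq_single_of_mem j₀ hmem]
    · rw [if_pos]; rw [hj₀c]; exact (Int.mul_ediv_cancel' hdvd).symm
    · intro j _ hne
      rw [if_neg]
      intro heq
      apply hne
      have : (j : ℤ) = d / k := by rw [heq, Int.mul_ediv_cancel_left _ hk0]
      have : (j : ℤ) = j₀ := by rw [this, hj₀c]
      exact_mod_cast this
  · rw [if_neg h]
    refine Finset.sum_eq_zero fun j hj => ?_
    rw [if_neg]
    intro heq
    apply h
    rw [Finset.mem_Ico] at hj
    have hq : d / k = j := by rw [heq, Int.mul_ediv_cancel_left _ hk0]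
    refine ⟨⟨j, heq⟩, ?_, ?_⟩ <;> rw [hq] <;> omega

/-- **Residue splitting** (exact reindexing `m = k y + r`, `m' = k y' + r`): for `1 ≤ k ≤ M`,
`R_k = Σ_{r<k} Σ_{(y,y') ∈ ((M−r)/k,(2M−r)/k]², y − y' ∈ [Q,2Q)} λ((ky+r)n+c) λ((ky'+r)n'+c)`,
`Q = ⌊√M⌋ + 1` — each summand is a UNIT fan (a window of `Q` consecutive lags of the cross sum of
`λ` along the two arithmetic progressions `k ℕ n + (r n + c)`, `k ℕ n' + (r n' + c)`). [folklore] -/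
theorem stub_residueSplitting :
    ∀ (c : ℤ) (n n' M k : ℕ), 1 ≤ k → k ≤ M →
      (∑ j ∈ Finset.Ico (Nat.sqrt M + 1) (2 * (Nat.sqrt M + 1)),
          ∑ p ∈ (Finset.Ioc M (2 * M) ×ˢ Finset.Ioc M (2 * M)).filter
              (fun p : ℕ × ℕ => (p.1 : ℤ) - p.2 = (k : ℤ) * (j : ℤ)),
            (ArithmeticFunction.liouville (Int.toNat ((p.1 : ℤ) * n + c)) : ℝ) *
              (ArithmeticFunction.liouville (Int.toNat ((p.2 : ℤ) * n' + c)) : ℝ)) =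
        ∑ r ∈ Finset.range k,
          ∑ p ∈ (Finset.Ioc ((M - r) / k) ((2 * M - r) / k) ×ˢ
                  Finset.Ioc ((M - r) / k) ((2 * M - r) / k)).filter
              (fun p : ℕ × ℕ => (Nat.sqrt M : ℤ) + 1 ≤ (p.1 : ℤ) - p.2 ∧
                (p.1 : ℤ) - p.2 < 2 * ((Nat.sqrt M : ℤ) + 1)),
            (ArithmeticFunction.liouville (Int.toNat (((k : ℤ) * p.1 + r) * n + c)) : ℝ) *
              (ArithmeticFunction.liouville (Int.toNat (((k : ℤ) * p.2 + r) * n' + c)) : ℝ) := by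
  intro c n n' M k hk hkM
  have hk0 : 0 < k := hk
  have hkz : (k : ℤ) ≠ 0 := by exact_mod_cast (show k ≠ 0 by omega)
  set Qn : ℕ := Nat.sqrt M + 1 with hQn
  have eQ : ((Nat.sqrt M : ℤ) + 1) = ((Qn : ℕ) : ℤ) := by rw [hQn]; push_cast; ring
  simp only [eQ]
  set box : Finset ℕ := Finset.Ioc M (2 * M) with hbox
  -- the summand as a function of the pair (m, m')
  set g : ℕ × ℕ → ℝ := fun p =>
    (liouville (Int.toNat ((p.1 : ℤ) * n + c)) : ℝ) *
      (liouville (Int.toNat ((p.2 : ℤ) * n' + c)) : ℝ) with hg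
  -- the fan condition on a pair
  set cond : ℕ × ℕ → Prop := fun p =>
    (k : ℤ) ∣ ((p.1 : ℤ) - p.2) ∧ (Qn : ℤ) ≤ ((p.1 : ℤ) - p.2) / k ∧
      ((p.1 : ℤ) - p.2) / k < 2 * (Qn : ℤ) with hcond
  -- Step A: the fan sum is the sum of g over the pairs satisfying cond
  have hA : (∑ j ∈ Finset.Ico Qn (2 * Qn),
      ∑ p ∈ (box ×ˢ box).filter (fun p : ℕ × ℕ => (p.1 : ℤ) - p.2 = (k : ℤ) * (j : ℤ)), g p) =
        ∑ p ∈ (box ×ˢ box).filter cond, g p := by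
    have : ∀ j ∈ Finset.Ico Qn (2 * Qn),
        (∑ p ∈ (box ×ˢ box).filter (fun p : ℕ × ℕ => (p.1 : ℤ) - p.2 = (k : ℤ) * (j : ℤ)), g p) =
          ∑ p ∈ box ×ˢ box, if (p.1 : ℤ) - p.2 = (k : ℤ) * (j : ℤ) then g p else 0 := by
      intro j _; rw [Finset.sum_filter]
    rw [Finset.sum_congr rfl this, Finset.sum_comm, Finset.sum_filter]
    refine Finset.sum_congr rfl fun p _ => ?_
    exact sum_Ico_ite_eq_mul ((p.1 : ℤ) - p.2) k Qn hk (g p)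
  -- Step B: the right-hand side as a sum over triples (r, (y, y'))
  set big : Finset (ℕ × ℕ) := Finset.Ioc 0 (2 * M) ×ˢ Finset.Ioc 0 (2 * M) with hbig
  set P : ℕ × (ℕ × ℕ) → Prop := fun x =>
    (x.2.1 ∈ Finset.Ioc ((M - x.1) / k) ((2 * M - x.1) / k) ∧
      x.2.2 ∈ Finset.Ioc ((M - x.1) / k) ((2 * M - x.1) / k)) ∧
    ((Qn : ℤ) ≤ (x.2.1 : ℤ) - x.2.2 ∧ (x.2.1 : ℤ) - x.2.2 < 2 * (Qn : ℤ)) with hP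
  set f : ℕ × (ℕ × ℕ) → ℝ := fun x =>
    (liouville (Int.toNat (((k : ℤ) * x.2.1 + x.1) * n + c)) : ℝ) *
      (liouville (Int.toNat (((k : ℤ) * x.2.2 + x.1) * n' + c)) : ℝ) with hf
  have hB : (∑ r ∈ Finset.range k,
      ∑ p ∈ (Finset.Ioc ((M - r) / k) ((2 * M - r) / k) ×ˢ
              Finset.Ioc ((M - r) / k) ((2 * M - r) / k)).filter
          (fun p : ℕ × ℕ => (Qn : ℤ) ≤ (p.1 : ℤ) - p.2 ∧ (p.1 : ℤ) - p.2 < 2 * (Qn : ℤ)),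
        (liouville (Int.toNat (((k : ℤ) * p.1 + r) * n + c)) : ℝ) *
          (liouville (Int.toNat (((k : ℤ) * p.2 + r) * n' + c)) : ℝ)) =
        ∑ x ∈ (Finset.range k ×ˢ big).filter P, f x := by
    rw [Finset.sum_filter, Finset.sum_product]
    refine Finset.sum_congr rfl fun r hr => ?_
    rw [Finset.sum_filter]
    -- enlarge the inner box to `big`
    have hsub : Finset.Ioc ((M - r) / k) ((2 * M - r) / k) ⊆ Finset.Ioc 0 (2 * M) := by
      intro y hy
      rw [Finset.mem_Ioc] at hy ⊢
      refine ⟨lt_of_le_of_lt (Nat.zero_le _) hy.1,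
        le_trans hy.2 (Nat.div_le_self _ _ |>.trans (Nat.sub_le _ _))⟩
    symm
    rw [← Finset.sum_subset (Finset.product_subset_product hsub hsub)]
    · refine Finset.sum_congr rfl fun q hq => ?_
      rw [Finset.mem_product] at hq
      simp only [hf]
      by_cases hw : (Qn : ℤ) ≤ (q.1 : ℤ) - q.2 ∧ (q.1 : ℤ) - q.2 < 2 * (Qn : ℤ)
      · rw [if_pos ⟨hq, hw⟩, if_pos hw]
      · rw [if_neg (fun h => hw h.2), if_neg hw]
    · intro q _ hq
      rw [if_neg]
      intro hPq
      exact hq (Finset.mem_product.mpr hPq.1)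
  rw [hA, hB]
  -- Step C: the bijection (r, (y, y')) ↦ (k y + r, k y' + r)
  symm
  refine Finset.sum_nbij' (fun x => (k * x.2.1 + x.1, k * x.2.2 + x.1))
    (fun p => (p.1 % k, (p.1 / k, p.2 / k))) ?_ ?_ ?_ ?_ ?_
  · -- maps into the filtered box
    intro x hx
    rw [Finset.mem_filter, Finset.mem_product, Finset.mem_range] at hx
    obtain ⟨⟨hr, _⟩, ⟨hy, hy'⟩, hw1, hw2⟩ := hx
    rw [Finset.mem_Ioc] at hy hy'
    have hrM : x.1 ≤ M := by omega
    rw [Finset.mem_filter, Finset.mem_product, hbox, Finset.mem_Ioc, Finset.mem_Ioc]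
    have h1 : M - x.1 < x.2.1 * k := (Nat.div_lt_iff_lt_mul hk0).mp hy.1
    have h2 : x.2.1 * k ≤ 2 * M - x.1 := (Nat.le_div_iff_mul_le hk0).mp hy.2
    have h3 : M - x.1 < x.2.2 * k := (Nat.div_lt_iff_lt_mul hk0).mp hy'.1
    have h4 : x.2.2 * k ≤ 2 * M - x.1 := (Nat.le_div_iff_mul_le hk0).mp hy'.2
    have h1' : M < x.2.1 * k + x.1 := (tsub_lt_iff_right hrM).mp h1
    have h2' : x.2.1 * k + x.1 ≤ 2 * M := (Nat.le_sub_iff_add_le (by omega)).mp h2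
    have h3' : M < x.2.2 * k + x.1 := (tsub_lt_iff_right hrM).mp h3
    have h4' : x.2.2 * k + x.1 ≤ 2 * M := (Nat.le_sub_iff_add_le (by omega)).mp h4
    refine ⟨⟨⟨?_, ?_⟩, ⟨?_, ?_⟩⟩, ?_⟩
    · show M < k * x.2.1 + x.1; linarith [mul_comm k x.2.1]
    · show k * x.2.1 + x.1 ≤ 2 * M; linarith [mul_comm k x.2.1]
    · show M < k * x.2.2 + x.1; linarith [mul_comm k x.2.2]
    · show k * x.2.2 + x.1 ≤ 2 * M; linarith [mul_comm k x.2.2]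
    · simp only [hcond]
      have hd : (((k * x.2.1 + x.1 : ℕ) : ℤ) - ((k * x.2.2 + x.1 : ℕ) : ℤ)) =
          (k : ℤ) * ((x.2.1 : ℤ) - x.2.2) := by push_cast; ring
      rw [hd, Int.mul_ediv_cancel_left _ hkz]
      exact ⟨dvd_mul_right _ _, hw1, hw2⟩
  · -- the inverse maps into the triples
    intro p hp
    rw [Finset.mem_filter, Finset.mem_product, hbox, Finset.mem_Ioc, Finset.mem_Ioc] at hp
    obtain ⟨⟨⟨h1, h2⟩, ⟨h3, h4⟩⟩, hdvd, hw1, hw2⟩ := hp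
    have hmod : p.2 % k = p.1 % k := Nat.modEq_iff_dvd.mpr hdvd
    have e2' : k * (p.2 / k) + p.1 % k = p.2 := by rw [← hmod]; exact Nat.div_add_mod p.2 k
    set y := p.1 / k with hy
    set y' := p.2 / k with hy'
    set r := p.1 % k with hr
    have e1 : k * y + r = p.1 := Nat.div_add_mod p.1 k
    have e2 : k * y' + r = p.2 := e2'
    have hlt : r < k := Nat.mod_lt _ hk0
    have hrM : r ≤ M := by omega
    rw [Finset.mem_filter, Finset.mem_product, Finset.mem_range]
    simp only [hP, hbig, Finset.mem_product, Finset.mem_Ioc]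
    have hd : ((p.1 : ℤ) - p.2) / k = (y : ℤ) - (y' : ℤ) := by
      have : ((p.1 : ℤ) - p.2) = (k : ℤ) * ((y : ℤ) - (y' : ℤ)) := by
        have a1 : ((p.1 : ℕ) : ℤ) = ((k * y + r : ℕ) : ℤ) := by rw [e1]
        have a2 : ((p.2 : ℕ) : ℤ) = ((k * y' + r : ℕ) : ℤ) := by rw [e2]
        rw [a1, a2]; simp only [Nat.cast_add, Nat.cast_mul]; ring
      rw [this, Int.mul_ediv_cancel_left _ hkz]
    rw [hd] at hw1 hw2
    have hy0 : 0 < y := Nat.pos_of_ne_zero fun h0 => by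
      rw [h0, mul_zero, zero_add] at e1; omega
    have hy0' : 0 < y' := Nat.pos_of_ne_zero fun h0 => by
      rw [h0, mul_zero, zero_add] at e2; omega
    have hyM : y ≤ 2 * M :=
      calc y ≤ k * y := Nat.le_mul_of_pos_left y hk0
        _ ≤ k * y + r := Nat.le_add_right _ _
        _ = p.1 := e1
        _ ≤ 2 * M := h2
    have hyM' : y' ≤ 2 * M :=
      calc y' ≤ k * y' := Nat.le_mul_of_pos_left y' hk0
        _ ≤ k * y' + r := Nat.le_add_right _ _
        _ = p.2 := e2
        _ ≤ 2 * M := h4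
    refine ⟨⟨hlt, ⟨hy0, hyM⟩, ⟨hy0', hyM'⟩⟩, ⟨⟨?_, ?_⟩, ⟨?_, ?_⟩⟩, hw1, hw2⟩
    · rw [Nat.div_lt_iff_lt_mul hk0, mul_comm]
      exact (tsub_lt_iff_right hrM).mpr (by rw [e1]; exact h1)
    · rw [Nat.le_div_iff_mul_le hk0, mul_comm]
      exact (Nat.le_sub_iff_add_le (by omega)).mpr (by rw [e1]; exact h2)
    · rw [Nat.div_lt_iff_lt_mul hk0, mul_comm]
      exact (tsub_lt_iff_right hrM).mpr (by rw [e2]; exact h3)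
    · rw [Nat.le_div_iff_mul_le hk0, mul_comm]
      exact (Nat.le_sub_iff_add_le (by omega)).mpr (by rw [e2]; exact h4)
  · -- left inverse
    intro x hx
    rw [Finset.mem_filter, Finset.mem_product, Finset.mem_range] at hx
    obtain ⟨⟨hr, _⟩, _⟩ := hx
    ext
    · show (k * x.2.1 + x.1) % k = x.1
      rw [Nat.mul_add_mod, Nat.mod_eq_of_lt hr]
    · show (k * x.2.1 + x.1) / k = x.2.1
      rw [Nat.mul_add_div hk0, Nat.div_eq_of_lt hr, add_zero]
    · show (k * x.2.2 + x.1) / k = x.2.2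
      rw [Nat.mul_add_div hk0, Nat.div_eq_of_lt hr, add_zero]
  · -- right inverse
    intro p hp
    rw [Finset.mem_filter] at hp
    obtain ⟨_, hdvd, _⟩ := hp
    have hmod : p.2 % k = p.1 % k := Nat.modEq_iff_dvd.mpr hdvd
    ext
    · show k * (p.1 / k) + p.1 % k = p.1
      exact Nat.div_add_mod p.1 k
    · show k * (p.2 / k) + p.1 % k = p.2
      rw [← hmod]; exact Nat.div_add_mod p.2 k
  · -- summands agree
    intro x _
    simp only [hf, hg, Nat.cast_add, Nat.cast_mul]

end Summit.Parity.GeneralizedHardyLittlewood.Theorems.FanDecorrelation.ResidueSplitting
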